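import Mathlib
import Literature.NumberTheory.Sieve.Maynard2016Lemma7NormFactor
import Literature.NumberTheory.LFunctions.MertensElementary
import HarnessLib

/-!
# Maynard 2016, Lemma 7 — the singular-series ratio behind display (6.34)

[cite: Maynard2016LargeGaps, Lemma 7 (proof, display (6.34))]

In the per-tuple form of Lemma 7 (`Lemma7Tuple`) the main term produced by the norm factor of
Lemma 6 and the `(k−1)`-slot lcm engine carries the factor
`P_w · 𝔖_small^{(k−1)} · N⁷ / (classCount(m) · 𝔖_small^{(k)} · Π_m)`, while the target carries
`1/|𝓡_m|` with `|𝓡_m| ≍ (U/m) 𝔖_y(m)/log x` (Lemma 3).  This file proves the prime-by-prime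
comparison that makes the constant of Lemma 7 **absolute** (independent of `k`, of the sieve data
and of `m`): for even `m`,
* `p ≤ w`:  `p (1−1/p)² · ((p−2)/(p−1))^{[p∤m]} = (p − ω_m(p)) (1 − 1/p)` exactly
  (`ω_m(p) = 1` if `p ∣ m`, `2` otherwise);
* `w < p ≤ y`, `p ∣ m`:  `(1+(k−1)/p) ≥ ((p−2)/(p−1)) (1+k/p)`;
so `log y · 𝔖_y(m) · P_w · 𝔖_small^{(k−1)} · ∏_{w<p≤y, p∣m}(1+(k−1)/p)
   ≥ [log y · ∏_{p≤y}(1−1/p) · ∏_{w<p≤y}(1−1/(p−1)²)] · classCount(m) · 𝔖_small^{(k)} · Π_m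
   ≥ (e^{−5}/2) · classCount(m) · 𝔖_small^{(k)} · Π_m`,
using the explicit Mertens bound of the tree (`MertensBound.exp_neg_div_log_le_prod_one_sub_inv`)
and `∏_{w<p≤y}(1−1/(p−1)²) ≥ 1 − 4 Σ_{p>w} 1/p² ≥ 1 − 4/⌊w⌋ ≥ 1/2`.
-/

open Filter Finset Real

namespace Literature.NumberTheory.Sieve.Maynard2016

open LcmEuler

/-- Weierstrass' product inequality `1 − Σ aᵢ ≤ ∏ (1 − aᵢ)` for `aᵢ ∈ [0,1]`. [folklore] -/
private theorem maynard7_one_sub_sum_le_prod {ι : Type*} (s : Finset ι) (a : ι → ℝ)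
    (h0 : ∀ i ∈ s, 0 ≤ a i) (h1 : ∀ i ∈ s, a i ≤ 1) :
    1 - ∑ i ∈ s, a i ≤ ∏ i ∈ s, (1 - a i) := by
  classical
  induction s using Finset.induction_on with
  | empty => simp
  | @insert j s hj ih =>
    rw [Finset.sum_insert hj, Finset.prod_insert hj]
    have hP : 1 - ∑ i ∈ s, a i ≤ ∏ i ∈ s, (1 - a i) :=
      ih (fun i hi => h0 i (Finset.mem_insert_of_mem hi))
        (fun i hi => h1 i (Finset.mem_insert_of_mem hi))
    have hj0 : 0 ≤ a j := h0 j (Finset.mem_insert_self j s)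
    have hj1 : a j ≤ 1 := h1 j (Finset.mem_insert_self j s)
    have hS : 0 ≤ ∑ i ∈ s, a i :=
      Finset.sum_nonneg fun i hi => h0 i (Finset.mem_insert_of_mem hi)
    nlinarith [mul_nonneg hj0 hS, mul_le_mul_of_nonneg_left hP (sub_nonneg.2 hj1)]

/-- `∏_{w < p ≤ y} (1 − 1/(p−1)²) ≥ 1/2` once `⌊w⌋ ≥ 8` (via `1/(p−1)² ≤ 4/p²` and
`Σ_{w<i≤y} 1/i² ≤ 1/⌊w⌋`). [folklore] -/
private theorem maynard7_half_le_prod_mid {ε : ℝ} {x : ℕ} (hw : 8 ≤ ⌊wFun x⌋₊)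
    (hwy : ⌊wFun x⌋₊ ≤ ⌊y ε x⌋₊) :
    (1 : ℝ) / 2 ≤ ∏ p ∈ midPrimes ε x, (1 - 1 / (((p : ℝ) - 1) ^ 2)) := by
  have hmem : ∀ p ∈ midPrimes ε x, ⌊wFun x⌋₊ < p ∧ p.Prime := fun p hp => by
    have h := Finset.mem_filter.1 hp
    exact ⟨(Finset.mem_Ioc.1 h.1).1, h.2⟩
  have h9 : ∀ p ∈ midPrimes ε x, (9 : ℝ) ≤ p := fun p hp => by
    have := (hmem p hp).1
    exact_mod_cast (show 9 ≤ p by omega)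
  -- `Σ_{p ∈ Mid} 1/(p−1)² ≤ 4 Σ_{i ∈ Ioc ⌊w⌋ ⌊y⌋} 1/i² ≤ 4/⌊w⌋ ≤ 1/2`
  have hsum : ∑ p ∈ midPrimes ε x, 1 / (((p : ℝ) - 1) ^ 2) ≤ 1 / 2 := by
    have h1 : ∑ p ∈ midPrimes ε x, 1 / (((p : ℝ) - 1) ^ 2) ≤
        ∑ p ∈ midPrimes ε x, 4 * (((p : ℝ)) ^ 2)⁻¹ := by
      refine Finset.sum_le_sum fun p hp => ?_
      have hp9 := h9 p hp
      have hp1 : (0 : ℝ) < ((p : ℝ) - 1) ^ 2 := pow_pos (by linarith) 2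
      have hp2 : (0 : ℝ) < (p : ℝ) ^ 2 := by positivity
      rw [show (4 : ℝ) * (((p : ℝ)) ^ 2)⁻¹ = 4 / (p : ℝ) ^ 2 by rw [div_eq_mul_inv],
        div_le_div_iff₀ hp1 hp2]
      nlinarith
    have h2 : ∑ p ∈ midPrimes ε x, 4 * (((p : ℝ)) ^ 2)⁻¹ ≤
        ∑ i ∈ Finset.Ioc ⌊wFun x⌋₊ ⌊y ε x⌋₊, 4 * (((i : ℝ)) ^ 2)⁻¹ :=
      Finset.sum_le_sum_of_subset_of_nonneg (Finset.filter_subset _ _)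
        fun i _ _ => by positivity
    have h3 : ∑ i ∈ Finset.Ioc ⌊wFun x⌋₊ ⌊y ε x⌋₊, 4 * (((i : ℝ)) ^ 2)⁻¹ ≤ 4 / ⌊wFun x⌋₊ := by
      rw [← Finset.mul_sum]
      have h := sum_Ioc_inv_sq_le_sub (α := ℝ) (show ⌊wFun x⌋₊ ≠ 0 by omega) hwy
      have hy0 : (0 : ℝ) ≤ ((⌊y ε x⌋₊ : ℕ) : ℝ)⁻¹ := by positivity
      calc 4 * ∑ i ∈ Finset.Ioc ⌊wFun x⌋₊ ⌊y ε x⌋₊, (((i : ℝ)) ^ 2)⁻¹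
          ≤ 4 * (((⌊wFun x⌋₊ : ℕ) : ℝ)⁻¹ - ((⌊y ε x⌋₊ : ℕ) : ℝ)⁻¹) := by gcongr
        _ ≤ 4 / ⌊wFun x⌋₊ := by rw [div_eq_mul_inv]; linarith
    have h4 : (4 : ℝ) / ⌊wFun x⌋₊ ≤ 1 / 2 := by
      have : (8 : ℝ) ≤ ⌊wFun x⌋₊ := by exact_mod_cast hw
      rw [div_le_div_iff₀ (by linarith) (by norm_num)]
      linarith
    linarith
  have hW := maynard7_one_sub_sum_le_prod (midPrimes ε x) (fun p => 1 / (((p : ℝ) - 1) ^ 2))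
    (fun p hp => by have := h9 p hp; positivity)
    (fun p hp => by
      have hp9 := h9 p hp
      rw [div_le_one (pow_pos (by linarith) 2)]; nlinarith)
  beta_reduce at hW
  linarith

set_option maxHeartbeats 400000 in
/-- **The singular-series ratio of Lemma 7** (the bookkeeping behind display (6.34), made
explicit): for `ε ≤ 1/2` and all large `x`, every `k ≥ 1` and every even `m`,
`(e^{−5}/2) · classCount(x,m) · 𝔖_small^{(k)}(x) · Π_m
  ≤ log y · 𝔖_y(m) · P_w · 𝔖_small^{(k−1)}(x) · ∏_{w<p≤y, p∣m} (1 + (k−1)/p)`.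
The constant `e^{−5}/2` is absolute. [cite: Maynard2016LargeGaps, Lemma 7 (proof, display (6.34))] -/
theorem eventually_lemma7_singRatio {ε : ℝ} (hε : ε ≤ 1 / 2) :
    ∀ᶠ x : ℕ in atTop, ∀ k : ℕ, 1 ≤ k → ∀ m : ℕ, Even m →
      Real.exp (-5) / 2 * (classCount x m * singSmall k x * mPart k ε x m) ≤
        Real.log (y ε x) * singProd ε x m * (Pw x : ℝ) * singSmall (k - 1) x *
          ∏ p ∈ (midPrimes ε x).filter (fun p => p ∣ m), (1 + ((k - 1 : ℕ) : ℝ) / p) := by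
  filter_upwards [eventually_le_wFun 8, eventually_floor_wFun_le_floor_y hε,
    eventually_wTrick hε] with x hw8 hwy hwt k hk m hm
  obtain ⟨-, hlogy, hwy1, -, -, -⟩ := hwt
  classical
  -- floors
  have hfw : 8 ≤ ⌊wFun x⌋₊ := Nat.le_floor (by exact_mod_cast hw8)
  have hy9 : (9 : ℝ) ≤ y ε x := by linarith
  have hfy : 9 ≤ ⌊y ε x⌋₊ := Nat.le_floor (by exact_mod_cast hy9)
  have hy0 : 0 ≤ y ε x := by linarith
  -- the three prime ranges
  set W : Finset ℕ := (Finset.Iic ⌊wFun x⌋₊).filter Nat.Prime with hWdef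
  set Mid : Finset ℕ := midPrimes ε x with hMiddef
  have hWmem : ∀ p ∈ W, p.Prime ∧ p ≤ ⌊wFun x⌋₊ := fun p hp => by
    have h := Finset.mem_filter.1 hp
    exact ⟨h.2, Finset.mem_Iic.1 h.1⟩
  have hW2 : ∀ p ∈ W, (2 : ℝ) ≤ p := fun p hp => by exact_mod_cast (hWmem p hp).1.two_le
  have hMidmem : ∀ p ∈ Mid, p.Prime ∧ ⌊wFun x⌋₊ < p ∧ p ≤ ⌊y ε x⌋₊ := fun p hp => by
    have h := Finset.mem_filter.1 hp
    exact ⟨h.2, (Finset.mem_Ioc.1 h.1).1, (Finset.mem_Ioc.1 h.1).2⟩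
  have hMid9 : ∀ p ∈ Mid, (9 : ℝ) ≤ p := fun p hp => by
    have := (hMidmem p hp).2.1
    exact_mod_cast (show 9 ≤ p by omega)
  have hWr : (Finset.range (⌊wFun x⌋₊ + 1)).filter Nat.Prime = W := by
    ext p
    simp only [hWdef, Finset.mem_filter, Finset.mem_range, Finset.mem_Iic, Nat.lt_succ_iff]
  have hLE : Nat.primesLE ⌊y ε x⌋₊ = W ∪ Mid := by
    ext p
    simp only [Nat.mem_primesLE, hWdef, hMiddef, midPrimes, Finset.mem_union, Finset.mem_filter,
      Finset.mem_Iic, Finset.mem_Ioc]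
    constructor
    · rintro ⟨hpy, hpp⟩
      by_cases hpw : p ≤ ⌊wFun x⌋₊
      · exact Or.inl ⟨hpw, hpp⟩
      · exact Or.inr ⟨⟨not_le.1 hpw, hpy⟩, hpp⟩
    · rintro (⟨hpw, hpp⟩ | ⟨⟨-, hpy⟩, hpp⟩)
      · exact ⟨hpw.trans hwy, hpp⟩
      · exact ⟨hpy, hpp⟩
  have hdisj : Disjoint W Mid := by
    rw [Finset.disjoint_left]
    intro p hpW hpM
    exact absurd (hMidmem p hpM).2.1 (not_lt.2 (hWmem p hpW).2)
  -- `P = ∏_{p ≤ w} (1 − 1/p) = φ(P_w)/P_w`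
  set P : ℝ := ∏ p ∈ W, (1 - 1 / (p : ℝ)) with hPdef
  have hPfac : ∀ p ∈ W, (1 : ℝ) / 2 ≤ 1 - 1 / (p : ℝ) := fun p hp => by
    have h2 := hW2 p hp
    have : 1 / (p : ℝ) ≤ 1 / 2 := by
      rw [div_le_div_iff₀ (by linarith) (by norm_num)]; linarith
    linarith
  have hPpos : 0 < P := Finset.prod_pos fun p hp => by linarith [hPfac p hp]
  -- (1) `𝔖_small^{(k−1)} = P² 𝔖_small^{(k)}`
  have hP0 : P ≠ 0 := hPpos.ne'
  have hsS : singSmall (k - 1) x = P ^ 2 * singSmall k x := by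
    rw [singSmall_eq_inv_pow, singSmall_eq_inv_pow, totient_div_Pw_eq, ← hWdef, ← hPdef]
    have h2k : 2 * k = 2 * (k - 1) + 2 := by omega
    rw [h2k, pow_add, mul_inv, mul_comm (P ^ 2), mul_assoc, inv_mul_cancel₀ (pow_ne_zero 2 hP0),
      mul_one]
  -- (2) `p ≤ w`: `P_w · P² · ∏_{p≤w, p∤m}(p−2)/(p−1) = classCount(m) · P`
  set A : ℝ := ∏ p ∈ W.filter (fun p => ¬ p ∣ m), (((p : ℝ) - 2) / ((p : ℝ) - 1)) with hAdef
  have hPw : (Pw x : ℝ) = ∏ p ∈ W, (p : ℝ) := by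
    rw [Pw, primorial, hWr, Nat.cast_prod]
  have hcc : classCount x m = ∏ p ∈ W, ((p : ℝ) - ((if p ∣ m then 1 else 2 : ℕ) : ℝ)) := by
    rw [classCount, hWr]
  have hA : A = ∏ p ∈ W, (if p ∣ m then (1 : ℝ) else ((p : ℝ) - 2) / ((p : ℝ) - 1)) := by
    rw [hAdef, Finset.prod_filter]
    refine Finset.prod_congr rfl fun p _ => ?_
    by_cases hpm : p ∣ m <;> simp [hpm]
  have hlow : (Pw x : ℝ) * P ^ 2 * A = classCount x m * P := by
    rw [hPw, hcc, hA, hPdef, ← Finset.prod_pow, ← Finset.prod_mul_distrib,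
      ← Finset.prod_mul_distrib, ← Finset.prod_mul_distrib]
    refine Finset.prod_congr rfl fun p hp => ?_
    have h2 := hW2 p hp
    have hp0 : (p : ℝ) ≠ 0 := by positivity
    have hp1 : (p : ℝ) - 1 ≠ 0 := by linarith
    by_cases hpm : p ∣ m
    · rw [if_pos hpm, if_pos hpm]
      push_cast
      field_simp
    · -- `p ∤ m`: the identity `p (1−1/p)² (p−2)/(p−1) = (p−2)(1−1/p)` is polynomial
      rw [if_neg hpm, if_neg hpm]
      push_cast
      field_simp
  -- (3) `𝔖_y(m) = A · B`, `B = ∏_{w<p≤y, p∤m} (p−2)/(p−1)`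
  set B : ℝ := ∏ p ∈ Mid.filter (fun p => ¬ p ∣ m), (((p : ℝ) - 2) / ((p : ℝ) - 1)) with hBdef
  have hsplit : (Finset.Iic ⌊y ε x⌋₊).filter (fun p => p.Prime ∧ ¬ p ∣ m) =
      W.filter (fun p => ¬ p ∣ m) ∪ Mid.filter (fun p => ¬ p ∣ m) := by
    rw [← Finset.filter_union, ← hLE]
    ext p
    simp only [Finset.mem_filter, Finset.mem_Iic, Nat.mem_primesLE, and_assoc]
  have hdisj' : Disjoint (W.filter (fun p => ¬ p ∣ m)) (Mid.filter (fun p => ¬ p ∣ m)) :=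
    Finset.disjoint_filter_filter hdisj
  have hsing : singProd ε x m = A * B := by
    rw [singProd, hsplit, Finset.prod_union hdisj']
  -- (4) `w < p ≤ y`, `p ∣ m`: `∏ (1+(k−1)/p) ≥ D · Π_m`, `D = ∏_{w<p≤y, p∣m} (p−2)/(p−1)`
  set D : ℝ := ∏ p ∈ Mid.filter (fun p => p ∣ m), (((p : ℝ) - 2) / ((p : ℝ) - 1)) with hDdef
  set N : ℝ := ∏ p ∈ Mid.filter (fun p => p ∣ m), (1 + ((k - 1 : ℕ) : ℝ) / p) with hNdef
  have hk1 : ((k - 1 : ℕ) : ℝ) = (k : ℝ) - 1 := by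
    rw [Nat.cast_sub hk, Nat.cast_one]
  have hDN : D * mPart k ε x m ≤ N := by
    rw [hDdef, mPart, ← hMiddef, ← Finset.prod_mul_distrib, hNdef]
    refine Finset.prod_le_prod (fun p hp => ?_) fun p hp => ?_
    · have h9 := hMid9 p (Finset.mem_filter.1 hp).1
      exact mul_nonneg (div_nonneg (by linarith) (by linarith)) (by positivity)
    · have h9 := hMid9 p (Finset.mem_filter.1 hp).1
      have hp0 : (0 : ℝ) < p := by linarith
      have hp1 : (0 : ℝ) < (p : ℝ) - 1 := by linarith
      rw [hk1]
      have key : (1 + ((k : ℝ) - 1) / p) - ((p : ℝ) - 2) / ((p : ℝ) - 1) * (1 + (k : ℝ) / p) =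
          ((k : ℝ) + 1) / (((p : ℝ) - 1) * p) := by
        field_simp
        ring
      have : 0 ≤ ((k : ℝ) + 1) / (((p : ℝ) - 1) * p) := by positivity
      linarith
  -- (5) `D · B = ∏_{w<p≤y} (p−2)/(p−1) = ∏ (1−1/p) · ∏ (1 − 1/(p−1)²)`
  have hDB : D * B = ∏ p ∈ Mid, (((p : ℝ) - 2) / ((p : ℝ) - 1)) := by
    rw [hDdef, hBdef, Finset.prod_filter_mul_prod_filter_not]
  have hMidsplit : ∏ p ∈ Mid, (((p : ℝ) - 2) / ((p : ℝ) - 1)) =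
      (∏ p ∈ Mid, (1 - 1 / (p : ℝ))) * ∏ p ∈ Mid, (1 - 1 / (((p : ℝ) - 1) ^ 2)) := by
    rw [← Finset.prod_mul_distrib]
    refine Finset.prod_congr rfl fun p hp => ?_
    have h9 := hMid9 p hp
    have hp0 : (p : ℝ) ≠ 0 := by positivity
    have hp1 : (p : ℝ) - 1 ≠ 0 := by
      have : (0 : ℝ) < (p : ℝ) - 1 := by linarith
      exact this.ne'
    field_simp
    ring
  -- (6) Mertens: `P · ∏_{Mid} (1−1/p) ≥ e^{−5}/log y`
  have hMert : Real.exp (-5) / Real.log (y ε x) ≤ P * ∏ p ∈ Mid, (1 - 1 / (p : ℝ)) := by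
    have h := Literature.NumberTheory.LFunctions.MertensBound.exp_neg_div_log_le_prod_one_sub_inv
      ⌊y ε x⌋₊ (by omega)
    rw [hLE, Finset.prod_union hdisj, ← hPdef] at h
    refine le_trans ?_ h
    have hfy0 : (0 : ℝ) < ((⌊y ε x⌋₊ : ℕ) : ℝ) := by positivity
    have hlogfy : 0 < Real.log ((⌊y ε x⌋₊ : ℕ) : ℝ) :=
      Real.log_pos (by exact_mod_cast (show 1 < ⌊y ε x⌋₊ by omega))
    have hle : Real.log ((⌊y ε x⌋₊ : ℕ) : ℝ) ≤ Real.log (y ε x) :=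
      Real.log_le_log hfy0 (Nat.floor_le hy0)
    exact div_le_div_of_nonneg_left (Real.exp_pos _).le hlogfy hle
  have hhalf : (1 : ℝ) / 2 ≤ ∏ p ∈ Mid, (1 - 1 / (((p : ℝ) - 1) ^ 2)) :=
    maynard7_half_le_prod_mid hfw hwy
  -- (7) assemble
  have hMid1 : 0 ≤ ∏ p ∈ Mid, (1 - 1 / (p : ℝ)) := Finset.prod_nonneg fun p hp => by
    have h9 := hMid9 p hp
    have : 1 / (p : ℝ) ≤ 1 / 9 := by
      rw [div_le_div_iff₀ (by linarith) (by norm_num)]; linarith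
    linarith
  have hkey : Real.exp (-5) / 2 ≤ Real.log (y ε x) * P * (D * B) := by
    rw [hDB, hMidsplit]
    have h1 : Real.exp (-5) ≤ Real.log (y ε x) * (P * ∏ p ∈ Mid, (1 - 1 / (p : ℝ))) := by
      have := (div_le_iff₀ hlogy).1 hMert
      linarith
    have h2 : 0 ≤ Real.log (y ε x) * (P * ∏ p ∈ Mid, (1 - 1 / (p : ℝ))) :=
      mul_nonneg hlogy.le (mul_nonneg hPpos.le hMid1)
    calc Real.exp (-5) / 2 = Real.exp (-5) * (1 / 2) := by ring
      _ ≤ (Real.log (y ε x) * (P * ∏ p ∈ Mid, (1 - 1 / (p : ℝ)))) *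
            ∏ p ∈ Mid, (1 - 1 / (((p : ℝ) - 1) ^ 2)) :=
          mul_le_mul h1 hhalf (by norm_num) h2
      _ = _ := by ring
  have hcc0 : 0 ≤ classCount x m := classCount_nonneg x m
  have hsS0 : 0 ≤ singSmall k x := (singSmall_pos k x).le
  have hmP0 : 0 ≤ mPart k ε x m := (mPart_pos k ε x m).le
  have hB0 : 0 ≤ B := Finset.prod_nonneg fun p hp => by
    have h9 := hMid9 p (Finset.mem_filter.1 hp).1
    exact div_nonneg (by linarith) (by linarith)
  have hT0 : 0 ≤ Real.log (y ε x) * classCount x m * P * B * singSmall k x := by positivity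
  calc Real.exp (-5) / 2 * (classCount x m * singSmall k x * mPart k ε x m)
      ≤ (Real.log (y ε x) * P * (D * B)) * (classCount x m * singSmall k x * mPart k ε x m) :=
        mul_le_mul_of_nonneg_right hkey (by positivity)
    _ = (Real.log (y ε x) * classCount x m * P * B * singSmall k x) * (D * mPart k ε x m) := by
        ring
    _ ≤ (Real.log (y ε x) * classCount x m * P * B * singSmall k x) * N :=
        mul_le_mul_of_nonneg_left hDN hT0
    _ = Real.log (y ε x) * B * (classCount x m * P) * singSmall k x * N := by ring
    _ = Real.log (y ε x) * B * ((Pw x : ℝ) * P ^ 2 * A) * singSmall k x * N := by rw [hlow]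
    _ = _ := by rw [hsing, hsS]; ring

end Literature.NumberTheory.Sieve.Maynard2016
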